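import Summits.SmoothPoincare4.SmoothPoincare4.Theorems.SblfDescentRungOneHelperBottFlowODE
import Literature.Geometry.Manifold.InjOnLocalDiffeomorphInverse
import Literature.Topology.FourManifolds.MorseExtrema
import Mathlib.Geometry.Manifold.Instances.Sphere
import Mathlib.Analysis.SpecialFunctions.Sqrt
import HarnessLib

/-!
# The global tube parametrisation of a Morse–Bott superlevel set (flow layer, part 2: the tube)

Auxiliary file (part 2 of 3) of helper `helper_bott_flow` of stub
`helper_sliceGluing_bottRecognition` (fibred Morse–Bott recognition of the polar tube), line
`Sketch`, crux `SblfDescent.RungOne`.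

(Crux item stmt-SmoothPoincare4-18531; skeleton `Cruxes/RungOne/Lines/Sketch.lean`.)

The setting (`BottFlow.Setup`): a closed smooth `4`-manifold `X`, smooth `F : X → ℝ` and
`β : X → ℝ²`, levels `a < b` with `F ≤ b` on `V = {a ≤ F}` and critical set of `F` in `V` a
circle `e(𝕊¹)`; a Morse–Bott tube `ν : 𝕊¹ × B(0, ε) → X` about the circle (`ν (u, 0) = e u`,
injective local diffeomorphism with open image, `F ∘ ν = b - ‖y‖²`, `β ∘ ν = u`); and a smooth
vector field `W` vanishing on the circle with `W(F) = 2 (F - b)`, `W(β) = 0` on `V`, with its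
global flow `θ` (Lee 2012, Thm. 9.12).  Along `θ`, `b - F` grows like `e^{2t}` and `β` is
constant while the trajectory is in `V` (part 1, `BottFlow.sub_apply_flow_eq`).  Here:

* `BottFlow.Setup.flow_level` — this law for trajectories of `V` off the circle;
* `BottFlow.Setup.exists_bound` — off the tube, `F ≤ m < b` on `V` (compactness);
* the **global tube** `BottFlow.Setup.Ν (u, y) = θ (½ log λ(‖y‖²), ν (u, y / √λ(‖y‖²)))`, with
  `λ` the profile of part 1 (`λ = 1` near `0`, so that `Ν = ν` near the circle, and
  `‖y‖² / λ(‖y‖²)` small, so that `ν` is only used inside its tube): it is smooth on all of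
  `𝕊¹ × ℝ³` and satisfies `F (Ν (u, y)) = b - ‖y‖²`, `β (Ν (u, y)) = u` for `‖y‖ ≤ √(b - a)`
  (`BottFlow.Setup.apply_Ν`).

(Milnor's proof of the regular interval theorem, *Morse theory* (1963), Thm. 3.1, run with the
first integral `β` and glued to the Morse–Bott chart along the maximum circle.)
## References

* J. Milnor, *Morse theory*, Ann. of Math. Studies 51 (1963), Thm. 3.1. [Milnor1963]
* J. M. Lee, *Introduction to Smooth Manifolds*, 2nd ed. (2012), Thm. 9.12, Thm. 4.5. [LeeSmoothManifolds2013]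
-/

set_option linter.dupNamespace false

noncomputable section

open scoped Manifold ContDiff Topology
open Set Function Filter Metric Literature.Topology.FourManifolds

namespace Summit.SmoothPoincare4.SmoothPoincare4.Cruxes.RungOne.Sketch

namespace BottFlow

/-! ### The setting -/

/-- **The data of the flow layer**: function, angular map, levels, circle, Morse–Bott tube,
vector field and flow, with their hypotheses (see the module docstring). [folklore] -/
structure Setup (X : Type) [TopologicalSpace X] [ChartedSpace (EuclideanSpace ℝ (Fin 4)) X]
    [IsManifold (𝓡 4) ∞ X] where
  /-- the Morse–Bott function -/
  F : X → ℝ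
  /-- the angular map -/
  β : X → EuclideanSpace ℝ (Fin 2)
  /-- the lower level -/
  a : ℝ
  /-- the critical (maximal) value -/
  b : ℝ
  /-- the radius of the tube -/
  ε : ℝ
  /-- the critical circle -/
  e : Metric.sphere (0 : EuclideanSpace ℝ (Fin 2)) 1 → X
  /-- the Morse–Bott tube -/
  ν : (Metric.sphere (0 : EuclideanSpace ℝ (Fin 2)) 1) × EuclideanSpace ℝ (Fin 3) → X
  /-- the vector field -/
  W : Π x : X, TangentSpace (𝓡 4) x
  /-- its flow -/
  θ : ℝ × X → X
  hab : a < b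
  hε : 0 < ε
  hF : ContMDiff (𝓡 4) 𝓘(ℝ, ℝ) ∞ F
  hβ : ContMDiff (𝓡 4) 𝓘(ℝ, EuclideanSpace ℝ (Fin 2)) ∞ β
  hFle : ∀ x, a ≤ F x → F x ≤ b
  hcrit : ∀ x, a ≤ F x → (IsMCriticalPt (𝓡 4) F x ↔ x ∈ range e)
  hν : ContMDiffOn ((𝓡 1).prod 𝓘(ℝ, EuclideanSpace ℝ (Fin 3))) (𝓡 4) ∞ ν (univ ×ˢ ball 0 ε)
  hinj : InjOn ν (univ ×ˢ ball 0 ε)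
  hopen : IsOpen (ν '' (univ ×ˢ ball 0 ε))
  hbij : ∀ p ∈ univ ×ˢ ball (0 : EuclideanSpace ℝ (Fin 3)) ε,
    Bijective (mfderiv ((𝓡 1).prod 𝓘(ℝ, EuclideanSpace ℝ (Fin 3))) (𝓡 4) ν p)
  hν0 : ∀ u, ν (u, 0) = e u
  hνF : ∀ (u : Metric.sphere (0 : EuclideanSpace ℝ (Fin 2)) 1) (y : EuclideanSpace ℝ (Fin 3)),
    ‖y‖ < ε → F (ν (u, y)) = b - ‖y‖ ^ 2 ∧ β (ν (u, y)) = u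
  hW : ContMDiff (𝓡 4) (𝓡 4).tangent ∞ (fun x => (⟨x, W x⟩ : TangentBundle (𝓡 4) X))
  hW0 : ∀ u, W (e u) = 0
  hcons : ∀ x, a ≤ F x → mfderiv (𝓡 4) 𝓘(ℝ, ℝ) F x (W x) = 2 * (F x - b) ∧
    mfderiv (𝓡 4) 𝓘(ℝ, EuclideanSpace ℝ (Fin 2)) β x (W x) = 0
  hθ : ContMDiff (𝓘(ℝ, ℝ).prod (𝓡 4)) (𝓡 4) ∞ θ
  hθ0 : ∀ p, θ (0, p) = p
  hθadd : ∀ t s p, θ (t, θ (s, p)) = θ (t + s, p)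
  hθint : ∀ p, IsMIntegralCurve (fun t => θ (t, p)) W

namespace Setup

variable {X : Type} [TopologicalSpace X] [ChartedSpace (EuclideanSpace ℝ (Fin 4)) X]
  [IsManifold (𝓡 4) ∞ X] (D : Setup X)

/-! ### Levels, the circle, and the flow -/

/-- `F ≤ b` everywhere (off `V` one has `F < a < b`). [folklore] -/
theorem apply_le (x : X) : D.F x ≤ D.b := by
  by_cases h : D.a ≤ D.F x
  · exact D.hFle x h
  · linarith [D.hab, not_le.1 h]

/-- **A point where `F = b` lies on the circle** (it is a maximum of `F`, hence critical).
[folklore] -/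
theorem mem_range_of_apply_eq {x : X} (hx : D.F x = D.b) : x ∈ range D.e := by
  have hmax : IsLocalMax D.F x := Filter.Eventually.of_forall fun y => (D.apply_le y).trans_eq hx.symm
  exact (D.hcrit x (by rw [hx]; exact D.hab.le)).1 hmax.isMCriticalPt

/-- Off the circle, `F < b`. [folklore] -/
theorem apply_lt_of_not_mem {x : X} (hx : x ∉ range D.e) : D.F x < D.b :=
  lt_of_le_of_ne (D.apply_le x) fun h => hx (D.mem_range_of_apply_eq h)

/-- On the circle, `F = b`. [folklore] -/
theorem apply_e (u : Metric.sphere (0 : EuclideanSpace ℝ (Fin 2)) 1) : D.F (D.e u) = D.b := by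
  have h := (D.hνF u 0 (by rw [norm_zero]; exact D.hε)).1
  rwa [D.hν0, norm_zero, zero_pow two_ne_zero, sub_zero] at h

/-- On the circle, `β (e u) = u`. [folklore] -/
theorem β_e (u : Metric.sphere (0 : EuclideanSpace ℝ (Fin 2)) 1) :
    D.β (D.e u) = (u : EuclideanSpace ℝ (Fin 2)) := by
  have h := (D.hνF u 0 (by rw [norm_zero]; exact D.hε)).2
  rwa [D.hν0] at h

/-- The tube meets the circle only along the zero section: `ν (u, y) = e u'` with `‖y‖ < ε`
forces `y = 0`. [folklore] -/
theorem eq_zero_of_ν_eq_e {u u' : Metric.sphere (0 : EuclideanSpace ℝ (Fin 2)) 1}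
    {y : EuclideanSpace ℝ (Fin 3)} (hy : ‖y‖ < D.ε) (h : D.ν (u, y) = D.e u') : y = 0 := by
  rw [← D.hν0] at h
  have h1 : (u, y) ∈ univ ×ˢ ball (0 : EuclideanSpace ℝ (Fin 3)) D.ε :=
    Set.mk_mem_prod (mem_univ u) (mem_ball_zero_iff.2 hy)
  have h2 : (u', (0 : EuclideanSpace ℝ (Fin 3))) ∈ univ ×ˢ ball (0 : EuclideanSpace ℝ (Fin 3)) D.ε :=
    Set.mk_mem_prod (mem_univ u') (mem_ball_self D.hε)
  have := D.hinj h1 h2 h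
  exact (Prod.mk.inj this).2

section Flow

variable [T2Space X]

/-- **The circle is fixed by the flow.** [cite: LeeSmoothManifolds2013, Thm. 9.12] -/
theorem θ_e (t : ℝ) (u : Metric.sphere (0 : EuclideanSpace ℝ (Fin 2)) 1) : D.θ (t, D.e u) = D.e u :=
  flow_apply_of_eq_zero D.hW D.hθ0 D.hθint (D.hW0 u) t

/-- Trajectories off the circle stay off the circle. [folklore] -/
theorem θ_not_mem {x : X} (hx : x ∉ range D.e) (t : ℝ) : D.θ (t, x) ∉ range D.e := by
  rintro ⟨u, hu⟩
  apply hx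
  refine ⟨u, ?_⟩
  have h := D.hθadd (-t) t x
  rw [neg_add_cancel, D.hθ0, ← hu, D.θ_e] at h
  exact h

/-- **The level and the angle along the flow** (part 1 applied): for `x ∈ V` off the circle and
`(b - F x) e^{2t} ≤ b - a`, `b - F (θ (t, x)) = (b - F x) e^{2t}` and `β (θ (t, x)) = β x`.
[cite: Milnor1963, proof of Thm. 3.1] -/
theorem flow_level {x : X} (hx : D.a ≤ D.F x) (hxe : x ∉ range D.e) {t : ℝ}
    (ht : (D.b - D.F x) * Real.exp (2 * t) ≤ D.b - D.a) :
    D.b - D.F (D.θ (t, x)) = (D.b - D.F x) * Real.exp (2 * t) ∧ D.β (D.θ (t, x)) = D.β x := by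
  have hlt : ∀ s, D.F (D.θ (s, x)) < D.b := fun s => D.apply_lt_of_not_mem (D.θ_not_mem hxe s)
  exact ⟨sub_apply_flow_eq D.hF D.hθ0 D.hθint (fun z hz => (D.hcons z hz).1) hx hlt ht,
    apply_flow_eq_of_mfderiv_eq_zero D.hF D.hθ0 D.hθint (fun z hz => (D.hcons z hz).1) D.hβ
      (fun z hz => (D.hcons z hz).2) hx hlt ht⟩

end Flow

/-! ### Off the tube `F` stays away from `b` -/

section Tube

variable [CompactSpace X]

/-- **Off the tube, `F ≤ m < b` on `V`** (the set `V ∖ ν(tube)` is compact and misses the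
circle, where alone `F = b`). [folklore] -/
theorem exists_bound : ∃ m : ℝ, m < D.b ∧ ∀ z, D.a ≤ D.F z → z ∉ D.ν '' (univ ×ˢ ball 0 D.ε) → D.F z ≤ m := by
  set C : Set X := {z | D.a ≤ D.F z} ∩ (D.ν '' (univ ×ˢ ball 0 D.ε))ᶜ with hC
  have hCc : IsCompact C :=
    ((isClosed_le continuous_const D.hF.continuous).inter D.hopen.isClosed_compl).isCompact
  rcases C.eq_empty_or_nonempty with hCe | hCne
  · refine ⟨D.a - 1, by linarith [D.hab], fun z hz hz' => ?_⟩
    have : z ∈ C := ⟨hz, hz'⟩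
    rw [hCe] at this
    exact this.elim
  · obtain ⟨z₀, hz₀, hmax⟩ := hCc.exists_isMaxOn hCne D.hF.continuous.continuousOn
    have hz₀e : z₀ ∉ range D.e := by
      rintro ⟨u, rfl⟩
      exact hz₀.2 ⟨(u, 0), Set.mk_mem_prod (mem_univ u) (mem_ball_self D.hε), D.hν0 u⟩
    exact ⟨D.F z₀, D.apply_lt_of_not_mem hz₀e, fun z hz hz' => hmax ⟨hz, hz'⟩⟩

/-- The bound `m < b` of `exists_bound` (a choice). [folklore] -/
def bound : ℝ := Classical.choose D.exists_bound

/-- `m < b`. [folklore] -/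
theorem bound_lt : D.bound < D.b := (Classical.choose_spec D.exists_bound).1

/-- Off the tube, `F ≤ m` on `V`. [folklore] -/
theorem apply_le_bound {z : X} (hz : D.a ≤ D.F z) (hz' : z ∉ D.ν '' (univ ×ˢ ball 0 D.ε)) :
    D.F z ≤ D.bound :=
  (Classical.choose_spec D.exists_bound).2 z hz hz'

/-- A point of `V` with `F > m` lies in the tube. [folklore] -/
theorem mem_image_of_bound_lt {z : X} (hz : D.a ≤ D.F z) (hlt : D.bound < D.F z) :
    z ∈ D.ν '' (univ ×ˢ ball 0 D.ε) := by
  by_contra h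
  exact absurd (D.apply_le_bound hz h) (not_le.2 hlt)

/-! ### The profile and the shrinking map -/

/-- The scale `s₀ = min (ε²/4) ((b - m)/4) > 0` below which the tube is used as is. [folklore] -/
def s₀ : ℝ := min (D.ε ^ 2 / 4) ((D.b - D.bound) / 4)

/-- **The scale `s₀`**: `0 < s₀`, `2 s₀ < ε²`, `2 s₀ < b - m`. [folklore] -/
theorem s₀_spec : 0 < D.s₀ ∧ 2 * D.s₀ < D.ε ^ 2 ∧ 2 * D.s₀ < D.b - D.bound := by
  have h1 : D.s₀ ≤ D.ε ^ 2 / 4 := min_le_left _ _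
  have h2 : D.s₀ ≤ (D.b - D.bound) / 4 := min_le_right _ _
  have h3 : 0 < D.ε ^ 2 := by have := D.hε; positivity
  have h4 := D.bound_lt
  exact ⟨lt_min (by linarith) (by linarith), by linarith, by linarith⟩

/-- **The profile `λ`** of part 1 at the scale `s₀` (a choice): `C^∞`, `= 1` on `(-∞, s₀]`,
`≥ 1`, `s / λ(s) ≤ 2 s₀`. [folklore] -/
def lam : ℝ → ℝ := Classical.choose (exists_profile D.s₀_spec.1)

/-- `λ` is smooth. [folklore] -/
theorem contDiff_lam : ContDiff ℝ ∞ D.lam := (Classical.choose_spec (exists_profile D.s₀_spec.1)).1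
/-- `λ(s) = 1` for `s ≤ s₀`. [folklore] -/
theorem lam_of_le {s : ℝ} (hs : s ≤ D.s₀) : D.lam s = 1 := (Classical.choose_spec (exists_profile D.s₀_spec.1)).2.1 s hs

/-- `1 ≤ λ(s)`. [folklore] -/
theorem one_le_lam (s : ℝ) : 1 ≤ D.lam s := (Classical.choose_spec (exists_profile D.s₀_spec.1)).2.2.1 s
/-- `0 < λ(s)`. [folklore] -/
theorem lam_pos (s : ℝ) : 0 < D.lam s := lt_of_lt_of_le one_pos (D.one_le_lam s)
/-- `s / λ(s) ≤ 2 s₀`. [folklore] -/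
theorem div_lam_le (s : ℝ) : s / D.lam s ≤ 2 * D.s₀ := (Classical.choose_spec (exists_profile D.s₀_spec.1)).2.2.2 s
/-- `√λ(s) > 0`. [folklore] -/
theorem sqrt_lam_pos (s : ℝ) : 0 < √(D.lam s) := Real.sqrt_pos.2 (D.lam_pos s)

/-- **The shrinking map** `y ↦ y / √λ(‖y‖²)`: the identity near `0`, with values in the ball of
radius `√(2 s₀) < ε`. [folklore] -/
def shrink (y : EuclideanSpace ℝ (Fin 3)) : EuclideanSpace ℝ (Fin 3) := (√(D.lam (‖y‖ ^ 2)))⁻¹ • y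

/-- **The flow time** `½ log λ(‖y‖²)`: zero near `0`. [folklore] -/
def time (y : EuclideanSpace ℝ (Fin 3)) : ℝ := 1 / 2 * Real.log (D.lam (‖y‖ ^ 2))

/-- `‖shrink y‖² = ‖y‖² / λ(‖y‖²)`. [folklore] -/
theorem norm_shrink_sq (y : EuclideanSpace ℝ (Fin 3)) : ‖D.shrink y‖ ^ 2 = ‖y‖ ^ 2 / D.lam (‖y‖ ^ 2) := by
  rw [shrink, norm_smul, mul_pow, norm_inv, inv_pow, Real.norm_eq_abs, sq_abs,
    Real.sq_sqrt (D.lam_pos _).le]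
  ring

/-- `‖shrink y‖ < ε`. [folklore] -/
theorem norm_shrink_lt (y : EuclideanSpace ℝ (Fin 3)) : ‖D.shrink y‖ < D.ε := by
  have h1 : ‖D.shrink y‖ ^ 2 < D.ε ^ 2 := by
    rw [D.norm_shrink_sq]
    exact lt_of_le_of_lt (D.div_lam_le _) D.s₀_spec.2.1
  exact (pow_lt_pow_iff_left₀ (norm_nonneg _) D.hε.le two_ne_zero).1 h1

/-- `‖shrink y‖ ≤ ‖y‖`. [folklore] -/
theorem norm_shrink_sq_le (y : EuclideanSpace ℝ (Fin 3)) : ‖D.shrink y‖ ^ 2 ≤ ‖y‖ ^ 2 := by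
  rw [D.norm_shrink_sq]
  exact div_le_self (sq_nonneg _) (D.one_le_lam _)

/-- `shrink y` lies in the tube. [folklore] -/
theorem shrink_mem (u : Metric.sphere (0 : EuclideanSpace ℝ (Fin 2)) 1) (y : EuclideanSpace ℝ (Fin 3)) :
    (u, D.shrink y) ∈ univ ×ˢ ball (0 : EuclideanSpace ℝ (Fin 3)) D.ε :=
  Set.mk_mem_prod (mem_univ u) (mem_ball_zero_iff.2 (D.norm_shrink_lt y))

/-- `shrink y = 0 ↔ y = 0`. [folklore] -/
theorem shrink_eq_zero_iff (y : EuclideanSpace ℝ (Fin 3)) : D.shrink y = 0 ↔ y = 0 := by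
  rw [shrink, smul_eq_zero, inv_eq_zero]
  exact ⟨fun h => h.resolve_left (D.sqrt_lam_pos _).ne', fun h => Or.inr h⟩

/-- `time 0 = 0`. [folklore] -/
@[simp] theorem time_zero : D.time 0 = 0 := by
  rw [time, norm_zero, zero_pow two_ne_zero, D.lam_of_le D.s₀_spec.1.le, Real.log_one, mul_zero]

/-- `exp (2 time y) = λ(‖y‖²)`. [folklore] -/
theorem exp_two_mul_time (y : EuclideanSpace ℝ (Fin 3)) : Real.exp (2 * D.time y) = D.lam (‖y‖ ^ 2) := by
  rw [time, ← mul_assoc, show (2 : ℝ) * (1 / 2) = 1 by norm_num, one_mul, Real.exp_log (D.lam_pos _)]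

/-- `√λ(‖y‖²) • shrink y = y`. [folklore] -/
theorem sqrt_lam_smul_shrink (y : EuclideanSpace ℝ (Fin 3)) : √(D.lam (‖y‖ ^ 2)) • D.shrink y = y := by
  rw [shrink, smul_smul, mul_inv_cancel₀ (D.sqrt_lam_pos _).ne', one_smul]

/-- `shrink` and `time` are smooth. [folklore] -/
theorem contDiff_shrink_time : ContDiff ℝ ∞ D.shrink ∧ ContDiff ℝ ∞ D.time := by
  have h1 : ContDiff ℝ ∞ fun y : EuclideanSpace ℝ (Fin 3) => D.lam (‖y‖ ^ 2) :=
    D.contDiff_lam.comp (contDiff_norm_sq ℝ)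
  have h2 : ContDiff ℝ ∞ fun y : EuclideanSpace ℝ (Fin 3) => (√(D.lam (‖y‖ ^ 2)))⁻¹ :=
    (h1.sqrt fun y => (D.lam_pos _).ne').inv fun y => (D.sqrt_lam_pos _).ne'
  exact ⟨h2.smul contDiff_id, contDiff_const.mul (h1.log fun y => (D.lam_pos _).ne')⟩

/-! ### The global tube `Ν` -/

/-- **The global tube** `Ν (u, y) = θ (time y, ν (u, shrink y))`. [folklore] -/
def Ν (p : (Metric.sphere (0 : EuclideanSpace ℝ (Fin 2)) 1) × EuclideanSpace ℝ (Fin 3)) : X :=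
  D.θ (D.time p.2, D.ν (p.1, D.shrink p.2))

/-- **`Ν` is smooth on all of `𝕊¹ × ℝ³`.** [folklore] -/
theorem contMDiff_Ν : ContMDiff ((𝓡 1).prod 𝓘(ℝ, EuclideanSpace ℝ (Fin 3))) (𝓡 4) ∞ D.Ν := by
  have h1 : ContMDiff ((𝓡 1).prod 𝓘(ℝ, EuclideanSpace ℝ (Fin 3))) 𝓘(ℝ, ℝ) ∞
      fun p : (Metric.sphere (0 : EuclideanSpace ℝ (Fin 2)) 1) × EuclideanSpace ℝ (Fin 3) => D.time p.2 :=
    D.contDiff_shrink_time.2.comp_contMDiff contMDiff_snd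
  have h2 : ContMDiff ((𝓡 1).prod 𝓘(ℝ, EuclideanSpace ℝ (Fin 3)))
      ((𝓡 1).prod 𝓘(ℝ, EuclideanSpace ℝ (Fin 3))) ∞
      fun p : (Metric.sphere (0 : EuclideanSpace ℝ (Fin 2)) 1) × EuclideanSpace ℝ (Fin 3) =>
        (p.1, D.shrink p.2) :=
    contMDiff_fst.prodMk (D.contDiff_shrink_time.1.comp_contMDiff contMDiff_snd)
  have h3 : ContMDiff ((𝓡 1).prod 𝓘(ℝ, EuclideanSpace ℝ (Fin 3))) (𝓡 4) ∞
      fun p : (Metric.sphere (0 : EuclideanSpace ℝ (Fin 2)) 1) × EuclideanSpace ℝ (Fin 3) =>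
        D.ν (p.1, D.shrink p.2) :=
    D.hν.comp_contMDiff h2 fun p => D.shrink_mem p.1 p.2
  exact D.hθ.comp (h1.prodMk h3)

/-- `Ν (u, 0) = e u`. [folklore] -/
@[simp] theorem Ν_zero (u : Metric.sphere (0 : EuclideanSpace ℝ (Fin 2)) 1) : D.Ν (u, 0) = D.e u := by
  rw [Ν, (D.shrink_eq_zero_iff 0).2 rfl, time_zero, D.hν0, D.hθ0]

/-- The base point `ν (u, shrink y)` of the formula for `Ν (u, y)`: in `V`, with
`b - F = ‖y‖²/λ(‖y‖²)` and `β = u`. [folklore] -/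
theorem apply_ν_shrink (u : Metric.sphere (0 : EuclideanSpace ℝ (Fin 2)) 1) (y : EuclideanSpace ℝ (Fin 3)) :
    D.F (D.ν (u, D.shrink y)) = D.b - ‖y‖ ^ 2 / D.lam (‖y‖ ^ 2) ∧
      D.β (D.ν (u, D.shrink y)) = (u : EuclideanSpace ℝ (Fin 2)) := by
  have h := D.hνF u (D.shrink y) (D.norm_shrink_lt y)
  rw [D.norm_shrink_sq] at h
  exact h

end Tube

section Both

variable [T2Space X] [CompactSpace X]

/-- **The level and the angle of `Ν`**: `F (Ν (u, y)) = b - ‖y‖²` and `β (Ν (u, y)) = u` for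
`‖y‖ ≤ √(b - a)`. [cite: Milnor1963, proof of Thm. 3.1] -/
theorem apply_Ν {u : Metric.sphere (0 : EuclideanSpace ℝ (Fin 2)) 1} {y : EuclideanSpace ℝ (Fin 3)}
    (hy : ‖y‖ ≤ √(D.b - D.a)) :
    D.F (D.Ν (u, y)) = D.b - ‖y‖ ^ 2 ∧ D.β (D.Ν (u, y)) = (u : EuclideanSpace ℝ (Fin 2)) := by
  by_cases hy0 : y = 0
  · subst hy0
    rw [Ν_zero, norm_zero, zero_pow two_ne_zero, sub_zero]
    exact ⟨D.apply_e u, D.β_e u⟩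
  have hba : 0 < D.b - D.a := by linarith [D.hab]
  have hy2 : ‖y‖ ^ 2 ≤ D.b - D.a := by
    calc ‖y‖ ^ 2 ≤ √(D.b - D.a) ^ 2 := pow_le_pow_left₀ (norm_nonneg _) hy 2
      _ = D.b - D.a := Real.sq_sqrt hba.le
  obtain ⟨hF0, hβ0⟩ := D.apply_ν_shrink u y
  -- the base point is in `V` and off the circle
  have hx : D.a ≤ D.F (D.ν (u, D.shrink y)) := by
    rw [hF0]
    have := div_le_self (sq_nonneg ‖y‖) (D.one_le_lam (‖y‖ ^ 2))
    linarith
  have hxe : D.ν (u, D.shrink y) ∉ range D.e := by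
    rintro ⟨u', hu'⟩
    exact hy0 ((D.shrink_eq_zero_iff y).1 (D.eq_zero_of_ν_eq_e (D.norm_shrink_lt y) hu'.symm))
  have ht : (D.b - D.F (D.ν (u, D.shrink y))) * Real.exp (2 * D.time y) ≤ D.b - D.a := by
    rw [hF0, sub_sub_cancel, D.exp_two_mul_time, div_mul_cancel₀ _ (D.lam_pos _).ne']
    exact hy2
  obtain ⟨h1, h2⟩ := D.flow_level hx hxe ht
  rw [hF0, sub_sub_cancel, D.exp_two_mul_time, div_mul_cancel₀ _ (D.lam_pos _).ne'] at h1
  refine ⟨?_, ?_⟩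
  · show D.F (D.θ (D.time y, D.ν (u, D.shrink y))) = D.b - ‖y‖ ^ 2
    linarith
  · show D.β (D.θ (D.time y, D.ν (u, D.shrink y))) = u
    rw [h2, hβ0]

end Both

end Setup

end BottFlow

end Summit.SmoothPoincare4.SmoothPoincare4.Cruxes.RungOne.Sketch

end
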